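import Literature.NumberTheory.EllipticCurves.Milne1972.WeilRestrictionQuadraticBSDQuotientAnyModel
import Summits.BirchSwinnertonDyer.BirchSwinnertonDyer.Theorems.GenusKolyvaginAtTwoRankOneShaCellBSDTwoRegulatorDoubling
import Summits.BirchSwinnertonDyer.BirchSwinnertonDyer.Theorems.GenusKolyvaginAtTwoRankOneShaCellBSDTwoLocalTwoTorsionParity
import Summits.BirchSwinnertonDyer.BirchSwinnertonDyer.Theorems.CMKolyvaginAtInertTwoShaCountTorsionAtTwo
import Literature.NumberTheory.EllipticCurves.Rank1Residual.X10Proofs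
import Literature.NumberTheory.EllipticCurves.LFunctionSmulProofs
import Literature.NumberTheory.EllipticCurves.BSDInvariantsProofs
import Literature.NumberTheory.EllipticCurves.BSDQuadraticDescentPeriodEliminationProofs
import Literature.NumberTheory.EllipticCurves.TwoTorsionOddDegreeBaseChangeProofs
import Literature.NumberTheory.EllipticCurves.LeadingTerm
import Literature.NumberTheory.EllipticCurves.BSDQuadraticDescentTorsionOddPartProofs
import Literature.NumberTheory.EllipticCurves.BSDSelmerParityDokchitserProp417Proofs
import Literature.NumberTheory.EllipticCurves.ComplexPeriodProofs
import Literature.NumberTheory.EllipticCurves.TamagawaFiniteIndexProofs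
import Literature.NumberTheory.EllipticCurves.RegulatorProofs
import Literature.NumberTheory.EllipticCurves.MordellWeilProofs
import HarnessLib

/-!
# GK₂ route `GenusKolyvaginAtTwo`, crux `RankOneShaCellBSDTwo` (stmt-27477), LINE 41 «restriction_rigidity»:
# stub ISO₂ ASSEMBLED from Milne's any-model quotient and four `2`-adic bookkeeping inputs

THEOREMS ONLY (no definition, no named fact, no `sorry`; standard axioms).  Nothing about BSD or the crux is
proved; this is the COMPOSITION step of LINE 41's print-grade stub ISO₂ `ShaQuadraticBookkeepingAtTwo`
(`#Ш(W_K)[2^∞] = #Ш(W)[2^∞] · #Ш(Wd)[2^∞] · 2^{e + 𝟙[0<Δ_W] − 1}`, `e = Σ_{ℓ∣d_K} i_ℓ(W)`), reducing it to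
Milne's any-model Weil-restriction identity (named fact `Milne1972.bsdQuotient_baseChange_quadratic_anyModel`
= the route's PRINT item `MilneAnyModel`, stmt-24149) and FOUR bookkeeping inputs in tree currency:

* (R) regulator `Reg(W_K) = 2·Reg(W)`, `Reg(Wd) = 1` — PROVED on the Ш-cell frame
  (`Bookkeeping.regulator_baseChange_eq_two_mul_regulator_rat`, file `…RegulatorDoubling`;
  `regulator_eq_one_of_rank_zero`);
* (P) period `Ω(W)·Ω(Wd) = n_W · Ω(W_K/K)`, `n_W = #π₀(W(ℝ)) ∈ {1,2}` — the tree's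
  `realPeriod_mul_realPeriod_quadraticTwist_eq_mul_bsdPeriod` gives it for the twist MODEL `W^{(d_K)}`;
  for the globally minimal `Wd = C_d • W^{(d_K)}` it remains to show `|u_d| = 1` (OPEN here, hypothesis);
* (T) Tamagawa `C(W_K/K, ω_W)·2^e = C(W)·C(Wd)` with `e = Σ_{ℓ∣d_K} i_ℓ(W)` (`c_ℓ(Wd) = 1 + #roots = 2^{i_ℓ}`
  at `ℓ ∣ d_K`, tree `TwistIstar.localTamagawaNumber_padic_twist_eq_one_add_card`; split primes cancel)
  — OPEN here as a global assembly, hypothesis;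
* (Tor) the three torsion orders are ODD (no `2`-torsion; tree `odd_torsionOrder_of_forall_two_nsmul` &c.).

`natCard_shaPrimary_baseChange_eq_of_bookkeeping`: given Milne's identity and (R), (P), (T), (Tor) as
hypotheses (with abstract `n ∈ {1,2}` and `e`, `1 ≤ e + (n − 1)` — on the frame this is PAR, LEAD's
`LocalParity.localTwoTorsionParity`), **`Ш(W_K)` is finite and
`#Ш(W_K)[2^∞] = #Ш(W)[2^∞] · #Ш(Wd)[2^∞] · 2^{e + (n−1) − 1}`**: cross-multiplying Milne's identity and
cancelling `Reg(W)·Ω(W_K)·C(W_K) > 0` leaves the natural-number identity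
`2·#Ш(W_K)·#W_tors²·#Wd_tors² = n·2^e·#Ш(W)·#Ш(Wd)·#W_K,tors²`, whose `2`-adic valuation is the claim
(`#A[2^∞] = 2^{v₂ #A}`, tree `natCard_primaryComponent_eq_pow_padicValNat`).
[cite: Milne1972ArithmeticAV, §1 Thm. 1 (through DokchitserDokchitserAnnals2010, §2.1)] [cite: Kramer1981, Thm. 1]
-/

noncomputable section

open scoped Classical

namespace Summit.BirchSwinnertonDyer.BirchSwinnertonDyer.Theorems.GenusExact.ShaCell.Bookkeeping

open WeierstrassCurve NumberField Literature.NumberTheory.EllipticCurves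

/-- `v₂` of an odd number is `0`. [folklore] -/
private theorem padicValNat_two_eq_zero_of_odd {t : ℕ} (ht : Odd t) : padicValNat 2 t = 0 :=
  padicValNat.eq_zero_of_not_dvd fun h => (Nat.not_even_iff_odd.mpr ht) (even_iff_two_dvd.mpr h)

/-- `v₂ n = n − 1` for `n ∈ {1, 2}`. [folklore] -/
private theorem padicValNat_two_of_eq_one_or_two {n : ℕ} (hn : n = 1 ∨ n = 2) :
    padicValNat 2 n = n - 1 := by
  rcases hn with rfl | rfl
  · simp
  · simp

/-- **ISO₂ ASSEMBLED.**  `W/ℚ` globally minimal elliptic, `K` a quadratic field, `Wd` a globally minimal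
`ℚ`-model of `W^{(d_K)}`, `Ш(W)` and `Ш(Wd)` finite; GIVEN Milne's any-model Weil-restriction identity
(`hMilne`, PRINT), the regulator inputs `Reg(W_K) = 2 Reg(W)`, `Reg(Wd) = 1` (R), the period input
`Ω(W)·Ω(Wd) = n·Ω(W_K/K)` with `n ∈ {1,2}` (P), the Tamagawa input `C(W_K/K, ω_W)·2^e = C(W)·C(Wd)` (T),
odd torsion orders (Tor) and `1 ≤ e + (n−1)`: THEN `Ш(W_K)` is finite and
**`#Ш(W_K)[2^∞] = #Ш(W)[2^∞] · #Ш(Wd)[2^∞] · 2^{e + (n − 1) − 1}`.**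
[cite: Milne1972ArithmeticAV, §1 Thm. 1 (through DokchitserDokchitserAnnals2010, §2.1)] -/
theorem natCard_shaPrimary_baseChange_eq_of_bookkeeping
    (hMilne : Milne1972.bsdQuotient_baseChange_quadratic_anyModel)
    (W : WeierstrassCurve ℚ) [W.IsElliptic] [W.IsGloballyMinimal]
    (K : Type) [Field K] [NumberField K] (h2 : Module.finrank ℚ K = 2)
    (Wd : WeierstrassCurve ℚ) [Wd.IsElliptic] [Wd.IsGloballyMinimal]
    (hWd : ∃ C : VariableChange ℚ, C • W.quadraticTwist (NumberField.discr K : ℚ) = Wd)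
    (hShaW : W.ShaFinite) (hShaWd : Wd.ShaFinite)
    (hReg : (W.baseChange K).regulator = 2 * W.regulator) (hRegd : Wd.regulator = 1)
    {n : ℕ} (hn : n = 1 ∨ n = 2)
    (hPer : W.realPeriodRat * Wd.realPeriodRat = (n : ℝ) * (W.baseChange K).bsdPeriod)
    {e : ℕ} (hTam : (W.baseChange K).modifiedTamagawaProduct * 2 ^ e =
      ((W.tamagawaProduct * Wd.tamagawaProduct : ℕ) : ℚ))
    (hTK : Odd (W.baseChange K).torsionOrder) (hTW : Odd W.torsionOrder) (hTd : Odd Wd.torsionOrder)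
    (he : 1 ≤ e + (n - 1)) :
    Finite (W.baseChange K).sha ∧
      Nat.card (AddCommGroup.primaryComponent (W.baseChange K).sha 2) =
        Nat.card (AddCommGroup.primaryComponent W.sha 2) *
          Nat.card (AddCommGroup.primaryComponent Wd.sha 2) * 2 ^ (e + (n - 1) - 1) := by
  haveI hEK : (W.baseChange K).IsElliptic := by rw [baseChange]; infer_instance
  -- Milne's identity on the model `V = W ⊗ K`
  obtain ⟨hfinV, hq⟩ := hMilne W K h2 Wd hWd (W.baseChange K) ⟨1, one_smul _ _⟩ hShaW hShaWd
  haveI : Finite (W.baseChange K).sha := hfinV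
  haveI : Finite W.sha := hShaW
  haveI : Finite Wd.sha := hShaWd
  refine ⟨hfinV, ?_⟩
  -- positivity of the common factors
  have hR : 0 < W.regulator := W.regulator_pos'
  have hP : 0 < (W.baseChange K).bsdPeriod := (W.baseChange K).bsdPeriod_pos'
  have hC : (0 : ℝ) < ((W.baseChange K).modifiedTamagawaProduct : ℝ) := by
    exact_mod_cast (W.baseChange K).modifiedTamagawaProduct_pos
  have hTVpos : (0 : ℝ) < (W.baseChange K).torsionOrder := by
    exact_mod_cast (W.baseChange K).torsionOrder_pos_holds
  have hTWpos : (0 : ℝ) < W.torsionOrder := by exact_mod_cast W.torsionOrder_pos_holds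
  have hTdpos : (0 : ℝ) < Wd.torsionOrder := by exact_mod_cast Wd.torsionOrder_pos_holds
  -- the Tamagawa input in `ℝ`
  have hTamR : ((W.baseChange K).modifiedTamagawaProduct : ℝ) * 2 ^ e =
      (W.tamagawaProduct : ℝ) * (Wd.tamagawaProduct : ℝ) := by
    have := congrArg (fun q : ℚ => (q : ℝ)) hTam
    simpa using this
  -- cross-multiply: `2·S_V·T_W²·T_d² = n·2^e·S_W·S_d·T_V²`
  rw [W.bsdRHS_def, Wd.bsdRHS_def, hReg, hRegd] at hq
  have key : (2 : ℝ) * (W.baseChange K).shaOrder * (W.torsionOrder : ℝ) ^ 2 * (Wd.torsionOrder : ℝ) ^ 2 =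
      (n : ℝ) * 2 ^ e * W.shaOrder * Wd.shaOrder * ((W.baseChange K).torsionOrder : ℝ) ^ 2 := by
    have hTV0 : ((W.baseChange K).torsionOrder : ℝ) ^ 2 ≠ 0 := pow_ne_zero 2 hTVpos.ne'
    have hTW0 : (W.torsionOrder : ℝ) ^ 2 ≠ 0 := pow_ne_zero 2 hTWpos.ne'
    have hTd0 : (Wd.torsionOrder : ℝ) ^ 2 ≠ 0 := pow_ne_zero 2 hTdpos.ne'
    rw [div_mul_div_comm, div_eq_div_iff hTV0 (mul_ne_zero hTW0 hTd0)] at hq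
    -- substitute the period and Tamagawa inputs and cancel `Reg(W)·Ω(W_K)·C(W_K) > 0`
    have hRPC : (0 : ℝ) < W.regulator * (W.baseChange K).bsdPeriod *
        ((W.baseChange K).modifiedTamagawaProduct : ℝ) := by positivity
    have h' : (2 * ((W.baseChange K).shaOrder : ℝ) * (W.torsionOrder : ℝ) ^ 2 * (Wd.torsionOrder : ℝ) ^ 2 -
        (n : ℝ) * 2 ^ e * W.shaOrder * Wd.shaOrder * ((W.baseChange K).torsionOrder : ℝ) ^ 2) *
        (W.regulator * (W.baseChange K).bsdPeriod * ((W.baseChange K).modifiedTamagawaProduct : ℝ)) = 0 := by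
      linear_combination hq + (W.shaOrder : ℝ) * (Wd.shaOrder : ℝ) * W.regulator *
        ((W.baseChange K).torsionOrder : ℝ) ^ 2 * (W.tamagawaProduct : ℝ) * (Wd.tamagawaProduct : ℝ) * hPer -
        (W.shaOrder : ℝ) * (Wd.shaOrder : ℝ) * W.regulator * ((W.baseChange K).torsionOrder : ℝ) ^ 2 *
        (n : ℝ) * (W.baseChange K).bsdPeriod * hTamR
    rcases mul_eq_zero.mp h' with h | h
    · linarith
    · exact absurd h hRPC.ne'
  -- read it in `ℕ`
  have keyN : 2 * (W.baseChange K).shaOrder * W.torsionOrder ^ 2 * Wd.torsionOrder ^ 2 =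
      n * 2 ^ e * W.shaOrder * Wd.shaOrder * (W.baseChange K).torsionOrder ^ 2 := by
    exact_mod_cast key
  -- `2`-adic valuations
  haveI : Fact (Nat.Prime 2) := ⟨Nat.prime_two⟩
  have hSV : (W.baseChange K).shaOrder ≠ 0 := ((W.baseChange K).shaOrder_pos hfinV).ne'
  have hSW : W.shaOrder ≠ 0 := (W.shaOrder_pos hShaW).ne'
  have hSd : Wd.shaOrder ≠ 0 := (Wd.shaOrder_pos hShaWd).ne'
  have hTV : (W.baseChange K).torsionOrder ≠ 0 := (W.baseChange K).torsionOrder_pos_holds.ne'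
  have hTW' : W.torsionOrder ≠ 0 := W.torsionOrder_pos_holds.ne'
  have hTd' : Wd.torsionOrder ≠ 0 := Wd.torsionOrder_pos_holds.ne'
  have hn0 : n ≠ 0 := by rcases hn with rfl | rfl <;> decide
  have hval := congrArg (padicValNat 2) keyN
  have h2S : 2 * (W.baseChange K).shaOrder ≠ 0 := mul_ne_zero two_ne_zero hSV
  have h2ST : 2 * (W.baseChange K).shaOrder * W.torsionOrder ^ 2 ≠ 0 := mul_ne_zero h2S (pow_ne_zero 2 hTW')
  have hn2 : n * 2 ^ e ≠ 0 := mul_ne_zero hn0 (pow_ne_zero e two_ne_zero)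
  have hn2S : n * 2 ^ e * W.shaOrder ≠ 0 := mul_ne_zero hn2 hSW
  have hn2SS : n * 2 ^ e * W.shaOrder * Wd.shaOrder ≠ 0 := mul_ne_zero hn2S hSd
  have vL : padicValNat 2 (2 * (W.baseChange K).shaOrder * W.torsionOrder ^ 2 * Wd.torsionOrder ^ 2) =
      1 + padicValNat 2 (W.baseChange K).shaOrder := by
    rw [padicValNat.mul h2ST (pow_ne_zero 2 hTd'), padicValNat.mul h2S (pow_ne_zero 2 hTW'),
      padicValNat.mul two_ne_zero hSV, padicValNat.pow, padicValNat.pow, padicValNat_self,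
      padicValNat_two_eq_zero_of_odd hTW, padicValNat_two_eq_zero_of_odd hTd]
    omega
  have vR : padicValNat 2 (n * 2 ^ e * W.shaOrder * Wd.shaOrder * (W.baseChange K).torsionOrder ^ 2) =
      (n - 1) + e + padicValNat 2 W.shaOrder + padicValNat 2 Wd.shaOrder := by
    rw [padicValNat.mul hn2SS (pow_ne_zero 2 hTV), padicValNat.mul hn2S hSd, padicValNat.mul hn2 hSW,
      padicValNat.mul hn0 (pow_ne_zero e two_ne_zero), padicValNat.prime_pow, padicValNat.pow,
      padicValNat_two_eq_zero_of_odd hTK, padicValNat_two_of_eq_one_or_two hn]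
    omega
  rw [vL, vR] at hval
  -- `hval : 1 + v(S_V) = (n-1) + e + v(S_W) + v(S_d)`
  rw [natCard_primaryComponent_eq_pow_padicValNat 2 (A := (W.baseChange K).sha),
    natCard_primaryComponent_eq_pow_padicValNat 2 (A := W.sha),
    natCard_primaryComponent_eq_pow_padicValNat 2 (A := Wd.sha), ← pow_add, ← pow_add]
  congr 1
  change padicValNat 2 (W.baseChange K).shaOrder = padicValNat 2 W.shaOrder + padicValNat 2 Wd.shaOrder + _
  omega

/-- **ISO₂ ON THE Ш-CELL FRAME, modulo PRINT (GZK, Milne any-model) and the two remaining local inputs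
(P′) and (T).**  `W/ℚ` globally minimal elliptic of analytic rank `1` with NO rational `2`-torsion; `K`
imaginary quadratic with odd `d_K` satisfying the Heegner hypothesis for `N(W)`; `Wd` a globally minimal
model of `W^{(d_K)}` with `L(W^{(d_K)},1) ≠ 0`.  GIVEN (P′) `Ω(W)·Ω(Wd) = n_W·Ω(W_K/K)` for the minimal twin
(`n_W = #π₀(W(ℝ))`) and (T) `C(W_K/K, ω_W)·2^{Σ_{ℓ∣d_K} i_ℓ(W)} = C(W)·C(Wd)`, THEN `Ш(W_K)` is finite and
**`#Ш(W_K)[2^∞] = #Ш(W)[2^∞] · #Ш(Wd)[2^∞] · 2^{Σ_{ℓ∣d_K} i_ℓ(W) + 𝟙[0<Δ_W] − 1}`** — the text of LINE 41's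
`ShaQuadraticBookkeepingAtTwo` (with `localTwoTorsionDim` unfolded).  The regulator input is the tree's
`regulator_baseChange_eq_two_mul_regulator_rat` (ranks `1`/`0` by GZK), the torsion inputs are the tree's
odd-torsion lemmas, and `1 ≤ Σ i_ℓ + 𝟙[0<Δ]` is PAR (`LocalParity.localTwoTorsionParity`).
[cite: Milne1972ArithmeticAV, §1 Thm. 1 (through DokchitserDokchitserAnnals2010, §2.1)] [cite: Kramer1981, Thm. 1] -/
theorem natCard_shaPrimary_baseChange_eq_of_period_of_tamagawa
    (hGZK : rank_eq_analyticRank_of_analyticRank_le_one)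
    (hMilne : Milne1972.bsdQuotient_baseChange_quadratic_anyModel)
    (W : WeierstrassCurve ℚ) [W.IsElliptic] [W.IsGloballyMinimal]
    (hr : W.analyticRank = 1) (hT : ∀ P : W.toAffine.Point, (2 : ℕ) • P = 0 → P = 0)
    (K : Type) [Field K] [NumberField K] (hK : IsImaginaryQuadratic K) (hodd : Odd (NumberField.discr K))
    (hH : SatisfiesHeegnerHypothesis (W.conductorNorm ℤ) K)
    (Wd : WeierstrassCurve ℚ) [Wd.IsElliptic] [Wd.IsGloballyMinimal]
    (hWd : ∃ C : VariableChange ℚ, C • W.quadraticTwist (NumberField.discr K : ℚ) = Wd)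
    (hL : (W.quadraticTwist (NumberField.discr K : ℚ)).entireLFunction 1 ≠ 0)
    (hPer : W.realPeriodRat * Wd.realPeriodRat =
      ((W.baseChange ℝ).numRealComponents : ℝ) * (W.baseChange K).bsdPeriod)
    (hTam : (W.baseChange K).modifiedTamagawaProduct *
        2 ^ (Finset.sum (NumberField.discr K).natAbs.primeFactors (fun ℓ =>
          Nat.log 2 (Nat.card {x : ZMod ℓ // (WeierstrassCurve.twoTorsionPolynomial
            ((WeierstrassCurve.integralModelInt W).map (Int.castRingHom (ZMod ℓ)))).toPoly.eval x = 0} + 1))) =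
      ((W.tamagawaProduct * Wd.tamagawaProduct : ℕ) : ℚ)) :
    Finite (W.baseChange K).sha ∧
      Nat.card (AddCommGroup.primaryComponent (W.baseChange K).sha 2) =
        Nat.card (AddCommGroup.primaryComponent W.sha 2) *
          Nat.card (AddCommGroup.primaryComponent Wd.sha 2) *
          2 ^ (Finset.sum (NumberField.discr K).natAbs.primeFactors (fun ℓ =>
              Nat.log 2 (Nat.card {x : ZMod ℓ // (WeierstrassCurve.twoTorsionPolynomial
                ((WeierstrassCurve.integralModelInt W).map (Int.castRingHom (ZMod ℓ)))).toPoly.eval x = 0} + 1))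
            + (if 0 < W.Δ then 1 else 0) - 1) := by
  have hD : (NumberField.discr K : ℚ) ≠ 0 := by exact_mod_cast NumberField.discr_ne_zero K
  haveI := W.isElliptic_quadraticTwist hD
  obtain ⟨Cd, hCd⟩ := hWd
  -- GZK for `W`: rank `1`, `Ш(W)` finite
  obtain ⟨hrkW, hShaW⟩ := hGZK W hr.le
  rw [hr] at hrkW
  -- the twist has analytic rank `0`, hence (GZK) rank `0` and finite `Ш`
  have hrd0 : Wd.analyticRank = 0 := by
    rw [← hCd, analyticRank_smul]
    exact Rank1Residual.analyticRank_eq_zero_of_entireLFunction_one_ne_zero hL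
  obtain ⟨hrkWd, hShaWd⟩ := hGZK Wd (by rw [hrd0]; exact zero_le_one)
  rw [hrd0] at hrkWd
  have hrkTw : (W.quadraticTwist (NumberField.discr K : ℚ)).mordellWeilRank = 0 := by
    rw [← mordellWeilRank_variableChange_holds (W.quadraticTwist (NumberField.discr K : ℚ)) Cd, hCd, hrkWd]
  -- (R): regulators
  have hReg : (W.baseChange K).regulator = 2 * W.regulator :=
    regulator_baseChange_eq_two_mul_regulator_rat W K hK.1 hrkW hrkTw hT
  have hRegd : Wd.regulator = 1 := Wd.regulator_eq_one_of_rank_zero hrkWd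
  -- (Tor): the three torsion orders are odd
  have hT' := fun (Q : W.toAffine.Point)
      (hQ : @HSMul.hSMul ℕ W.toAffine.Point W.toAffine.Point
        (@instHSMul ℕ W.toAffine.Point (@NSMul.toSMul W.toAffine.Point (@AddMonoid.toNSMul W.toAffine.Point
          (@SubNegMonoid.toAddMonoid W.toAffine.Point (@AddGroup.toSubNegMonoid W.toAffine.Point
            (@AddCommGroup.toAddGroup W.toAffine.Point
              (@Affine.Point.instAddCommGroup ℚ _ W.toAffine fun a b => Classical.propDecidable (a = b)))))))) 2 Q = 0) =>
    hT Q (by convert hQ using 9)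
  have h2t : ∀ P : (W.baseChange K).toAffine.Point, (2 : ℕ) • P = 0 → P = 0 := fun P hP =>
    PlusDescent.forall_two_smul_eq_zero_baseChange_of_finrank_eq_two W K hK.1 two_ne_zero hT' P hP
  haveI hEK : (W.baseChange K).IsElliptic := by rw [baseChange]; infer_instance
  have hTK : Odd (W.baseChange K).torsionOrder :=
    ShaCountTwo.odd_torsionOrder_of_forall_two_nsmul (W.baseChange K) h2t
  have hTW : Odd W.torsionOrder := ShaCountTwo.odd_torsionOrder_of_forall_two_nsmul W hT'
  have hTd : Odd Wd.torsionOrder :=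
    ShaCountTwo.odd_torsionOrder_twist_of_forall_two_nsmul_baseChange W K hK.1 Wd ⟨Cd, hCd⟩ h2t
  -- `n = #π₀(W(ℝ)) ∈ {1, 2}` and `n − 1 = 𝟙[0 < Δ]`
  have hn : (W.baseChange ℝ).numRealComponents = 1 ∨ (W.baseChange ℝ).numRealComponents = 2 :=
    KrizLi2019.numRealComponents_eq_one_or W
  have hn1 : (W.baseChange ℝ).numRealComponents - 1 = if 0 < W.Δ then 1 else 0 := by
    rw [numRealComponents_baseChange_real]
    split_ifs <;> rfl
  -- `1 ≤ e + 𝟙[0<Δ]` is PAR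
  have hPAR := LocalParity.localTwoTorsionParity W K hK hodd hH
  have he : 1 ≤ Finset.sum (NumberField.discr K).natAbs.primeFactors (fun ℓ =>
      Nat.log 2 (Nat.card {x : ZMod ℓ // (WeierstrassCurve.twoTorsionPolynomial
        ((WeierstrassCurve.integralModelInt W).map (Int.castRingHom (ZMod ℓ)))).toPoly.eval x = 0} + 1)) +
      ((W.baseChange ℝ).numRealComponents - 1) := by
    rw [hn1]
    by_cases hΔ : 0 < W.Δ
    · rw [if_pos hΔ]; omega
    · rw [if_neg hΔ]
      have hneg : W.Δ < 0 := lt_of_le_of_ne (not_lt.mp hΔ) W.isUnit_Δ.ne_zero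
      rw [if_pos hneg] at hPAR
      omega
  obtain ⟨hfin, hcard⟩ := natCard_shaPrimary_baseChange_eq_of_bookkeeping hMilne W K hK.1 Wd ⟨Cd, hCd⟩
    hShaW hShaWd hReg hRegd hn hPer hTam hTK hTW hTd he
  refine ⟨hfin, ?_⟩
  rw [hcard, hn1]

end Summit.BirchSwinnertonDyer.BirchSwinnertonDyer.Theorems.GenusExact.ShaCell.Bookkeeping

end
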